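import Mathlib
import Summits.QuantumFields.QCD.Theses.PauliWegnerSea

/-!
# `FMClosureUnquenchedRepaired` — the lead's proposed restatement of crux K2 (stmt-QuantumFields-11512),
with a kernel-checked proof that it is a WEAKENING of the crux as filed

Lead report: `Cruxes/FMClosureUnquenched/LEAD-c1.md` (wave 1 of line `thick-collar-far-stability`).
Four over-claims of `FMClosureUnquenched` as typed are removed, nothing else is changed:

1. (A7 interface) the antecedent `FibreCofactorDomination` (K1) is replaced by its VOLUME-UNIFORM
   form `FibreCofactorDominationUniform` — the K1 text with the extensive factor `(1 + nw)` deleted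
   and `∃ C₀` moved in front of `∀ m₀` (the in-window count and its `θ₀` then disappear). This is a
   STRONGER antecedent (`fibreCofactorDomination_of_uniform`), hence a weaker implication; it is
   the form every line of this crux actually consumes ("K1 in LOCAL/uniform form", line cards of
   thick-collar-far-stability, sea-factorises-across-collars);
2. (ranges, refuter g44-0) two hypotheses on the regularisation are added inside `Core`:
   eventually `0 ≤ β_k`, and every bare mass eventually in `[-2, 2]` — the only ranges on which
   K1/K3 speak (an AF `OneScaleTrajectory` records both for free);
3. (A5) the one-scale input asks `2 ≤ ℓ₀` instead of `1 ≤ ℓ₀` (refuters' repair; the disprover's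
   `coreRepaired_of_core`);
4. (A6) clause (ii) is asked OUTWARD only: for `K (1 + |log a_k|) ≤ a_k ‖v‖` with one more
   existential constant `K` (the reading PhaseQuenchedFlavourDecay / GluonicCompletion consume at
   physical separations; the inward window with a k-uniform prefactor has no mechanism for odd
   `N_f`).

`repaired_of_original : FMClosureUnquenched → FMClosureUnquenchedRepaired` (sorry-free) certifies
that the restatement only REMOVES claims. The converse fails exactly at 1–4.
`FMClosureUnquenchedRepaired23` adds the optional restriction `N_f ∈ {2,3}` (what `closes` uses).
This is a crux WORKFILE (not a Theorems file): it defines candidate statement text for the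
planner; nothing here is registered.
-/

namespace Summit.QuantumFields.QCD.Cruxes.FMClosureUnquenched.Repair

open scoped BigOperators
open MeasureTheory Filter
open Literature.MathematicalPhysics.QuantumFieldTheory Literature.MathematicalPhysics.QuantumLattice
  Literature.Probability.LatticeModels
open Summit.QuantumFields.QCD.Theses.PauliWegnerSea

/-- **K1 in volume-uniform form** (proposed restatement of `FibreCofactorDomination`,
stmt-QuantumFields-11510): ONE constant `C₀` for all bare masses `m₀ ∈ [-2,2]`, all tori `L ≥ 4`, all
backgrounds and all pairs `x ≠ y`, and NO in-window mode count:
`sup_fibre Σ‖adj(D(refit W))_xy‖ ≤ C₀ · sup_fibre ‖det D(refit W′)‖`. Text = the route's K1 with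
`(1 + nw)` deleted and `∃ θ₀ C₀` replaced by a leading `∃ C₀`. -/
def FibreCofactorDominationUniform : Prop :=
  ∃ C₀ : ℝ, 0 < C₀ ∧ ∀ m₀ : ℝ, -2 ≤ m₀ → m₀ ≤ 2 → ∀ (L : ℕ) [NeZero L], 4 ≤ L →
    ∀ (U : GaugeConfig 4 L (Matrix.specialUnitaryGroup (Fin 3) ℂ)) (x y : TorusSite 4 L), x ≠ y →
      let star : Edge 4 L → Prop := fun e => e.1 = x ∨ Site.shift e.1 e.2 = x ∨ e.1 = y ∨ Site.shift e.1 e.2 = y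
      let refit : GaugeConfig 4 L (Matrix.specialUnitaryGroup (Fin 3) ℂ) →
          GaugeConfig 4 L (Matrix.specialUnitaryGroup (Fin 3) ℂ) := fun W e => if star e then W e else U e
      let D : GaugeConfig 4 L (Matrix.specialUnitaryGroup (Fin 3) ℂ) →
          Matrix (TorusSite 4 L × Fin 3 × Fin 4) (TorusSite 4 L × Fin 3 × Fin 4) ℂ :=
        fun V => wilsonDirac (fundamentalRep (Fin 3)) V m₀ 1
      ∀ W : GaugeConfig 4 L (Matrix.specialUnitaryGroup (Fin 3) ℂ),
        ∃ W' : GaugeConfig 4 L (Matrix.specialUnitaryGroup (Fin 3) ℂ),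
          (∑ a : Fin 3, ∑ i : Fin 4, ∑ b : Fin 3, ∑ j : Fin 4,
              ‖(D (refit W)).adjugate (x, a, i) (y, b, j)‖) ≤ C₀ * ‖(D (refit W')).det‖

/-- **The proposed restatement of K2.** `FibreCofactorDominationUniform → TiltedFlatness → ∀ Nf reg m > 0`,
IF eventually `0 ≤ β_k` and every bare mass `m_f(k) = m_crit(k) + a_k m_f/Z_m(k)` is eventually in
`[-2, 2]`, THEN the one-scale input WITH `2 ≤ ℓ₀` implies clause (ii) OUTWARD: for some `s, δ, C, K`,
eventually in `k`, for all `S ≥ L_k`, all flavours and all `v ∈ box S` with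
`K (1 + |log a_k|) ≤ a_k ‖v‖`, the phase-quenched fractional moment is `≤ C e^{-δ a_k ‖v‖}`.
(Integrands byte-identical to the route's.) -/
def FMClosureUnquenchedRepaired : Prop :=
  FibreCofactorDominationUniform → TiltedFlatness →
    ∀ (Nf : ℕ) (reg : QCDRegularisation Nf) (m : Fin Nf → ℝ), (∀ f, 0 < m f) →
      (∀ᶠ k in atTop, 0 ≤ reg.β k) →
      (∀ f : Fin Nf, ∀ᶠ k in atTop,
        -2 ≤ reg.mcrit k + reg.a k * m f / reg.Zm k ∧ reg.mcrit k + reg.a k * m f / reg.Zm k ≤ 2) →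
      (∀ q : ℕ, ∃ K₀ s : ℝ, 0 < s ∧ s < 1 ∧ ∀ᶠ k in atTop, ∃ ℓ₀ : ℕ, 2 ≤ ℓ₀ ∧ ℓ₀ ≤ reg.L k ∧
        (ℓ₀ : ℝ) * reg.a k ≤ K₀ * (1 + |Real.log (reg.a k)|) ∧
        ∀ S : ℕ, reg.L k ≤ S → ∀ (f : Fin Nf) (v : Literature.Probability.LatticeModels.Site 4),
          v ∈ box 4 S → ‖v‖ = (ℓ₀ : ℝ) →
            (ℓ₀ : ℝ) ^ q * (1 + |reg.β k|) ^ q *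
              ((∫ U : GaugeConfig 4 (2 * S + 1) (Matrix.specialUnitaryGroup (Fin 3) ℂ),
                  ‖(diracMatrix U fun fl => reg.mcrit k + reg.a k * m fl / reg.Zm k).det‖ *
                    (∑ a : Fin 3, ∑ i : Fin 4, ∑ b : Fin 3, ∑ j : Fin 4,
                      ‖(diracMatrix U fun fl => reg.mcrit k + reg.a k * m fl / reg.Zm k)⁻¹
                        (quarkEquiv (f, (Torus.proj (2 * S + 1) 0, a, i)))
                        (quarkEquiv (f, (Torus.proj (2 * S + 1) (v), b, j)))‖) ^ s
                  ∂(wilsonMeasure (fundamentalRep (Fin 3)) (reg.β k))) /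
                (∫ U : GaugeConfig 4 (2 * S + 1) (Matrix.specialUnitaryGroup (Fin 3) ℂ),
                  ‖(diracMatrix U fun fl => reg.mcrit k + reg.a k * m fl / reg.Zm k).det‖
                  ∂(wilsonMeasure (fundamentalRep (Fin 3)) (reg.β k)))) ≤ 1) →
      ∃ s δ C K : ℝ, 0 < s ∧ s < 1 ∧ 0 < δ ∧ ∀ᶠ k in atTop, ∀ S : ℕ, reg.L k ≤ S →
        ∀ (f : Fin Nf) (v : Literature.Probability.LatticeModels.Site 4), v ∈ box 4 S →
          K * (1 + |Real.log (reg.a k)|) ≤ reg.a k * ‖v‖ →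
            (∫ U : GaugeConfig 4 (2 * S + 1) (Matrix.specialUnitaryGroup (Fin 3) ℂ),
                ‖(diracMatrix U fun fl => reg.mcrit k + reg.a k * m fl / reg.Zm k).det‖ *
                  (∑ a : Fin 3, ∑ i : Fin 4, ∑ b : Fin 3, ∑ j : Fin 4,
                    ‖(diracMatrix U fun fl => reg.mcrit k + reg.a k * m fl / reg.Zm k)⁻¹
                      (quarkEquiv (f, (Torus.proj (2 * S + 1) 0, a, i)))
                      (quarkEquiv (f, (Torus.proj (2 * S + 1) (v), b, j)))‖) ^ s
                ∂(wilsonMeasure (fundamentalRep (Fin 3)) (reg.β k))) /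
              (∫ U : GaugeConfig 4 (2 * S + 1) (Matrix.specialUnitaryGroup (Fin 3) ℂ),
                ‖(diracMatrix U fun fl => reg.mcrit k + reg.a k * m fl / reg.Zm k).det‖
                ∂(wilsonMeasure (fundamentalRep (Fin 3)) (reg.β k))) ≤
              C * Real.exp (-(δ * (reg.a k * ‖v‖)))

/-- **Optional further restriction** (lead report point 5): the same restatement for the flavour
numbers the assembly actually uses, `N_f ∈ {2, 3}` (`closes` instantiates K2 only there) — removes the
large-`N_f` bulk first-order coexistence hazard flagged for far-stability-type inputs
(hep-lat/0309159) at no cost to the route. -/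
def FMClosureUnquenchedRepaired23 : Prop :=
  FibreCofactorDominationUniform → TiltedFlatness →
    ∀ (Nf : ℕ) (reg : QCDRegularisation Nf) (m : Fin Nf → ℝ), Nf = 2 ∨ Nf = 3 → (∀ f, 0 < m f) →
      (∀ᶠ k in atTop, 0 ≤ reg.β k) →
      (∀ f : Fin Nf, ∀ᶠ k in atTop,
        -2 ≤ reg.mcrit k + reg.a k * m f / reg.Zm k ∧ reg.mcrit k + reg.a k * m f / reg.Zm k ≤ 2) →
      (∀ q : ℕ, ∃ K₀ s : ℝ, 0 < s ∧ s < 1 ∧ ∀ᶠ k in atTop, ∃ ℓ₀ : ℕ, 2 ≤ ℓ₀ ∧ ℓ₀ ≤ reg.L k ∧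
        (ℓ₀ : ℝ) * reg.a k ≤ K₀ * (1 + |Real.log (reg.a k)|) ∧
        ∀ S : ℕ, reg.L k ≤ S → ∀ (f : Fin Nf) (v : Literature.Probability.LatticeModels.Site 4),
          v ∈ box 4 S → ‖v‖ = (ℓ₀ : ℝ) →
            (ℓ₀ : ℝ) ^ q * (1 + |reg.β k|) ^ q *
              ((∫ U : GaugeConfig 4 (2 * S + 1) (Matrix.specialUnitaryGroup (Fin 3) ℂ),
                  ‖(diracMatrix U fun fl => reg.mcrit k + reg.a k * m fl / reg.Zm k).det‖ *
                    (∑ a : Fin 3, ∑ i : Fin 4, ∑ b : Fin 3, ∑ j : Fin 4,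
                      ‖(diracMatrix U fun fl => reg.mcrit k + reg.a k * m fl / reg.Zm k)⁻¹
                        (quarkEquiv (f, (Torus.proj (2 * S + 1) 0, a, i)))
                        (quarkEquiv (f, (Torus.proj (2 * S + 1) (v), b, j)))‖) ^ s
                  ∂(wilsonMeasure (fundamentalRep (Fin 3)) (reg.β k))) /
                (∫ U : GaugeConfig 4 (2 * S + 1) (Matrix.specialUnitaryGroup (Fin 3) ℂ),
                  ‖(diracMatrix U fun fl => reg.mcrit k + reg.a k * m fl / reg.Zm k).det‖
                  ∂(wilsonMeasure (fundamentalRep (Fin 3)) (reg.β k)))) ≤ 1) →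
      ∃ s δ C K : ℝ, 0 < s ∧ s < 1 ∧ 0 < δ ∧ ∀ᶠ k in atTop, ∀ S : ℕ, reg.L k ≤ S →
        ∀ (f : Fin Nf) (v : Literature.Probability.LatticeModels.Site 4), v ∈ box 4 S →
          K * (1 + |Real.log (reg.a k)|) ≤ reg.a k * ‖v‖ →
            (∫ U : GaugeConfig 4 (2 * S + 1) (Matrix.specialUnitaryGroup (Fin 3) ℂ),
                ‖(diracMatrix U fun fl => reg.mcrit k + reg.a k * m fl / reg.Zm k).det‖ *
                  (∑ a : Fin 3, ∑ i : Fin 4, ∑ b : Fin 3, ∑ j : Fin 4,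
                    ‖(diracMatrix U fun fl => reg.mcrit k + reg.a k * m fl / reg.Zm k)⁻¹
                      (quarkEquiv (f, (Torus.proj (2 * S + 1) 0, a, i)))
                      (quarkEquiv (f, (Torus.proj (2 * S + 1) (v), b, j)))‖) ^ s
                ∂(wilsonMeasure (fundamentalRep (Fin 3)) (reg.β k))) /
              (∫ U : GaugeConfig 4 (2 * S + 1) (Matrix.specialUnitaryGroup (Fin 3) ℂ),
                ‖(diracMatrix U fun fl => reg.mcrit k + reg.a k * m fl / reg.Zm k).det‖
                ∂(wilsonMeasure (fundamentalRep (Fin 3)) (reg.β k))) ≤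
              C * Real.exp (-(δ * (reg.a k * ‖v‖)))


/-- Uniform K1 implies the route's K1 (`θ₀ := 1`; `C₀ ≤ C₀ (1 + n_w)`): the proposed antecedent is
STRONGER, so an implication from it is weaker. -/
theorem fibreCofactorDomination_of_uniform :
    FibreCofactorDominationUniform → FibreCofactorDomination := by
  rintro ⟨C₀, hC₀, h⟩ m₀ hm₁ hm₂
  refine ⟨1, C₀, one_pos, hC₀, fun L _ hL U x y hxy => ?_⟩
  intro star refit D nw W
  obtain ⟨W', hW'⟩ := h m₀ hm₁ hm₂ L hL U x y hxy W
  refine ⟨W', hW'.trans ?_⟩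
  have hdet : 0 ≤ ‖(D (refit W')).det‖ := norm_nonneg _
  have hnw : (1 : ℝ) ≤ 1 + (nw : ℝ) := by
    have : (0 : ℝ) ≤ (nw : ℝ) := Nat.cast_nonneg _
    linarith
  calc C₀ * ‖(D (refit W')).det‖ = C₀ * 1 * ‖(D (refit W')).det‖ := by ring
    _ ≤ C₀ * (1 + (nw : ℝ)) * ‖(D (refit W')).det‖ := by gcongr

/-- **The restatement only removes claims**: the crux as filed implies the repaired crux
(K1-uniform ⇒ K1; input with `2 ≤ ℓ₀` ⇒ input with `1 ≤ ℓ₀`; (ii) for all `v` ⇒ (ii) outward;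
the range hypotheses are simply not used). -/
theorem repaired_of_original : FMClosureUnquenched → FMClosureUnquenchedRepaired := by
  intro hK2 hK1u hK3 Nf reg m hm _hβ _hmass hInR
  have hIn : ∀ q : ℕ, ∃ K₀ s : ℝ, 0 < s ∧ s < 1 ∧ ∀ᶠ k in atTop, ∃ ℓ₀ : ℕ, 1 ≤ ℓ₀ ∧ ℓ₀ ≤ reg.L k ∧
      (ℓ₀ : ℝ) * reg.a k ≤ K₀ * (1 + |Real.log (reg.a k)|) ∧
      ∀ S : ℕ, reg.L k ≤ S → ∀ (f : Fin Nf) (v : Literature.Probability.LatticeModels.Site 4),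
        v ∈ box 4 S → ‖v‖ = (ℓ₀ : ℝ) →
          (ℓ₀ : ℝ) ^ q * (1 + |reg.β k|) ^ q *
            ((∫ U : GaugeConfig 4 (2 * S + 1) (Matrix.specialUnitaryGroup (Fin 3) ℂ),
                ‖(diracMatrix U fun fl => reg.mcrit k + reg.a k * m fl / reg.Zm k).det‖ *
                  (∑ a : Fin 3, ∑ i : Fin 4, ∑ b : Fin 3, ∑ j : Fin 4,
                    ‖(diracMatrix U fun fl => reg.mcrit k + reg.a k * m fl / reg.Zm k)⁻¹
                      (quarkEquiv (f, (Torus.proj (2 * S + 1) 0, a, i)))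
                      (quarkEquiv (f, (Torus.proj (2 * S + 1) (v), b, j)))‖) ^ s
                ∂(wilsonMeasure (fundamentalRep (Fin 3)) (reg.β k))) /
              (∫ U : GaugeConfig 4 (2 * S + 1) (Matrix.specialUnitaryGroup (Fin 3) ℂ),
                ‖(diracMatrix U fun fl => reg.mcrit k + reg.a k * m fl / reg.Zm k).det‖
                ∂(wilsonMeasure (fundamentalRep (Fin 3)) (reg.β k)))) ≤ 1 := by
    intro q
    obtain ⟨K₀, s, hs0, hs1, hev⟩ := hInR q
    refine ⟨K₀, s, hs0, hs1, hev.mono fun k hk => ?_⟩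
    obtain ⟨ℓ₀, h2, hL, hwin, hsh⟩ := hk
    exact ⟨ℓ₀, by omega, hL, hwin, hsh⟩
  obtain ⟨s, δ, C, hs0, hs1, hδ, hev⟩ :=
    hK2 (fibreCofactorDomination_of_uniform hK1u) hK3 Nf reg m hm hIn
  exact ⟨s, δ, C, 1, hs0, hs1, hδ, hev.mono fun k hk S hS f v hv _ => hk S hS f v hv⟩

/-- The `N_f ∈ {2,3}` restriction is weaker still. -/
theorem repaired23_of_repaired : FMClosureUnquenchedRepaired → FMClosureUnquenchedRepaired23 :=
  fun h hK1u hK3 Nf reg m _ hm hβ hmass hInR => h hK1u hK3 Nf reg m hm hβ hmass hInR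

/-- The crux as filed implies the `N_f ∈ {2,3}` restatement. -/
theorem repaired23_of_original : FMClosureUnquenched → FMClosureUnquenchedRepaired23 :=
  fun h => repaired23_of_repaired (repaired_of_original h)

end Summit.QuantumFields.QCD.Cruxes.FMClosureUnquenched.Repair
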